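import Mathlib
import Summits.QuantumFields.YangMills.Theorems.ConvexGribovBodyContinuumLegGivenGapStubOsMatching
import Summits.QuantumFields.YangMills.Theorems.ConvexGribovBodyContinuumLegGivenGapCsclTorusForms
import Summits.QuantumFields.YangMills.Theorems.ConvexGribovBodyContinuumLegGivenGapStubCltOfCscl
import HarnessLib

/-!
# `ContinuumLegGivenGap` (stmt-QuantumFields-15828), line `Sketch`, reshape 18b: `stub_csclCore` — per-datum matching and time rounding at the scheme level (pair clause)

Support file for the crux item stmt-QuantumFields-15828 (registered glue stub `stub_csclCore` of line `Sketch`,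
reshape 18b). **Statement.** For a scheme `sch`, complex test functions `F`, `H` supported at ordered positive times
in `[δ, T₀]` with gaps `≥ δ > 0`, `t ≥ 0`, and the (UUVB) clause of the scheme: for every `ε > 0`, eventually in `k`,
the cluster defect `𝓓_k(ΘF* ⊗ T_tH) − 𝓓_k(ΘF*) 𝓓_k(H)` of the canonical curvature distributions and the truncated
OS pairing `𝒫°_{⌊t/a_k⌋₊}(𝔛ₖF, 𝔛ₖH) = ∫ conj 𝔛ₖF(Θ₀Ũ) 𝔛ₖH(τ_{s e₀}Ũ) dμ_k − conj(E 𝔛ₖF) E 𝔛ₖH` (`s = ⌊t/a_k⌋₊`) of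
the centred lattice representatives differ in norm by at most `ε`.
**Proof** (`csclCore_bound`: the defect is `≤ a_k K`, `K` uniform, at every step with the (UUVB) inequality,
`a_k < δ`, `a_k ≤ 1`, `T₀ + t + 1 ≤ a_k L_k`; then `a_k → 0`, `a_k L_k → ∞`). (1) ROUNDING `t ↦ a_k⌊t/a_k⌋₊ = τ`:
`𝓓_k(ΘF* ⊗ (T_tH − T_τH))` is bounded by the `k`-uniform E0′ bound on `⁰𝒮` (`Transl.norm_curvDistribution_le_of_uuvb`,
`isOffDiagonal_appendTensor_of_neg_of_pos`) times `2^{M+1}|ΘF*|_M · 4^M |T_tH|_{M+1} a_k`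
(`schwartzNorm_appendTensor_le`, `schwartzNorm_compSubConstCLM_sub_le`); (2) MATCHING: conjunct (i) of the landed OS
matching (`osMatching_pair_bound`) at `(F, T_τH)` in the slab `[δ, T₀ + t]`, then the EXACT lattice translation
`𝔛ₖ(T_{a s e₀}H)(Ũ) = 𝔛ₖH(τ_{s e₀}Ũ)` (`csclCore_lat_translate`); (3) conjunct (ii) (`osMatching_single_bound`) with
`𝓓_k(F) = E 𝔛ₖF`, `𝓓_k(H) = E 𝔛ₖH` (`Arp.curvDistribution_eq_integral_lat`) and `‖𝓓_k(H)‖` uniformly bounded.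
No definitions, no facts; Mathlib + landed tree lemmas only. [folklore]
-/

noncomputable section

namespace Summit.QuantumFields.YangMills.Theorems.ContinuumLegGivenGap

open scoped SchwartzMap ComplexConjugate
open Filter Topology MeasureTheory
open Literature.MathematicalPhysics.QuantumFieldTheory Literature.MathematicalPhysics.QuantumLattice
  Literature.MathematicalPhysics.AQFT Literature.Probability.LatticeModels
open Summit.QuantumFields.YangMills.Cruxes.ContinuumLimitOnTrajectory.TwoOrbitSynchronisation

section Helpers

variable {G : Type} [Group G] [TopologicalSpace G] [IsTopologicalGroup G] [CompactSpace G]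
  [MeasurableSpace G] [BorelSpace G]

/-- A positive ordered time slab lies in the positive off-diagonal region: all times are `> 0` and pairwise
distinct. [folklore] -/
theorem csclCore_slab_subset_pos {p : ℕ} {δ T : ℝ} (hδ : 0 < δ) :
    ({x | (∀ i, δ ≤ x i 0 ∧ x i 0 ≤ T) ∧ ∀ i i', i < i' → x i 0 + δ ≤ x i' 0} :
        Set (Fin p → EuclideanSpace ℝ (Fin 4))) ⊆
      {x | (∀ i, 0 < x i 0) ∧ Function.Injective fun i => x i 0} := by
  intro x hx
  refine ⟨fun l => lt_of_lt_of_le hδ (hx.1 l).1, fun l l' hll' => ?_⟩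
  by_contra hne
  rcases lt_or_gt_of_ne hne with hlt | hlt
  · have := hx.2 l l' hlt; dsimp only at hll'; linarith
  · have := hx.2 l' l hlt; dsimp only at hll'; linarith

/-- A test function supported in a positive ordered time slab is off-diagonal. [folklore] -/
theorem csclCore_isOffDiagonal_of_slab {p : ℕ} {H : 𝓢((Fin p → EuclideanSpace ℝ (Fin 4)), ℂ)} {δ T : ℝ}
    (hδ : 0 < δ) (hH : tsupport (H : (Fin p → EuclideanSpace ℝ (Fin 4)) → ℂ) ⊆
      {x | (∀ i, δ ≤ x i 0 ∧ x i 0 ≤ T) ∧ ∀ i i', i < i' → x i 0 + δ ≤ x i' 0}) : IsOffDiagonal H :=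
  IsOffDiagonal.of_tsupport_subset fun _ hx hxc =>
    not_mem_coincidenceLocus_of_injective
      (fun _ _ hij => (csclCore_slab_subset_pos hδ (hH hx)).2 (congrArg (fun y : EuclideanSpace ℝ (Fin 4) => y 0) hij))
      hxc

/-- The OS adjoint `ΘF*` of a test function supported in a positive ordered time slab is supported at negative,
pairwise distinct times. [folklore] -/
theorem csclCore_tsupport_osAdjoint {p : ℕ} {F : 𝓢((Fin p → EuclideanSpace ℝ (Fin 4)), ℂ)} {δ T : ℝ}
    (hδ : 0 < δ) (hF : tsupport (F : (Fin p → EuclideanSpace ℝ (Fin 4)) → ℂ) ⊆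
      {x | (∀ i, δ ≤ x i 0 ∧ x i 0 ≤ T) ∧ ∀ i i', i < i' → x i 0 + δ ≤ x i' 0}) :
    tsupport ((osAdjoint F : 𝓢((Fin p → EuclideanSpace ℝ (Fin 4)), ℂ)) : (Fin p → EuclideanSpace ℝ (Fin 4)) → ℂ) ⊆
      {x | (∀ i, x i 0 < 0) ∧ Function.Injective fun i => x i 0} := by
  intro x hx
  have h := csclCore_slab_subset_pos hδ (hF (OSReconstructionNoE1.tsupport_osAdjoint_subset F hx))
  simp only [Set.mem_setOf_eq, OSReconstructionNoE1.timeReflection_apply_zero] at h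
  refine ⟨fun i => ?_, fun i j hij => ?_⟩
  · have := h.1 (Fin.rev i); rw [Fin.rev_rev] at this; linarith
  · have := @h.2 (Fin.rev i) (Fin.rev j) (by dsimp only at hij ⊢; rw [Fin.rev_rev, Fin.rev_rev, hij])
    exact Fin.rev_injective this

/-- Time translates by `0 ≤ τ ≤ t` of a test function supported in the slab `[δ, T₀]` (ordered, gaps `≥ δ`) are
supported in the slab `[δ, T₀ + t]` (ordered, gaps `≥ δ`). [folklore] -/
theorem csclCore_tsupport_translate {p : ℕ} {H : 𝓢((Fin p → EuclideanSpace ℝ (Fin 4)), ℂ)} {δ T₀ t τ : ℝ}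
    (hτ : 0 ≤ τ) (hτt : τ ≤ t) (hH : tsupport (H : (Fin p → EuclideanSpace ℝ (Fin 4)) → ℂ) ⊆
      {x | (∀ i, δ ≤ x i 0 ∧ x i 0 ≤ T₀) ∧ ∀ i i', i < i' → x i 0 + δ ≤ x i' 0}) :
    tsupport ((translateMulti (EuclideanSpace.single 0 τ) H : 𝓢((Fin p → EuclideanSpace ℝ (Fin 4)), ℂ)) :
        (Fin p → EuclideanSpace ℝ (Fin 4)) → ℂ) ⊆
      {x | (∀ i, δ ≤ x i 0 ∧ x i 0 ≤ T₀ + t) ∧ ∀ i i', i < i' → x i 0 + δ ≤ x i' 0} := by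
  intro x hx
  have h := hH (Literature.MathematicalPhysics.QuantumLattice.tsupport_translateMulti_subset _ H hx)
  simp only [Set.mem_setOf_eq, PiLp.sub_apply, PiLp.single_apply, if_true] at h
  exact ⟨fun i => ⟨by linarith [(h.1 i).1], by linarith [(h.1 i).2]⟩, fun i i' hii' => by linarith [h.2 i i' hii']⟩

/-- **Lattice time rounding**: `t_k := a ⌊t / a⌋₊` satisfies `0 ≤ t_k ≤ t` and `t - t_k ≤ a` (`a > 0`, `t ≥ 0`).
[folklore] -/
theorem csclCore_floor {a t : ℝ} (ha : 0 < a) (ht : 0 ≤ t) :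
    0 ≤ a * (⌊t / a⌋₊ : ℕ) ∧ a * (⌊t / a⌋₊ : ℕ) ≤ t ∧ t - a * (⌊t / a⌋₊ : ℕ) ≤ a := by
  have h1 : a * (⌊t / a⌋₊ : ℝ) ≤ a * (t / a) :=
    mul_le_mul_of_nonneg_left (Nat.floor_le (div_nonneg ht ha.le)) ha.le
  have h2 : a * (t / a) ≤ a * ((⌊t / a⌋₊ : ℝ) + 1) :=
    mul_le_mul_of_nonneg_left (Nat.lt_floor_add_one (t / a)).le ha.le
  rw [mul_div_cancel₀ t ha.ne'] at h1 h2
  exact ⟨by positivity, h1, by linarith⟩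

/-- **Translation differences of time translates**: `|T_τH − T_tH|_M ≤ 4^M |T_tH|_{M+1} |τ − t|` for `|τ − t| ≤ 1`
(`T_τ H = (T_t H)(· − (τ − t)e₀)`, `schwartzNorm_compSubConstCLM_sub_le` at the constant vector, whose sup norm is
`≤ |τ − t|`). [folklore] -/
theorem csclCore_schwartzNorm_translate_sub (M : ℕ) {p : ℕ} (H : 𝓢((Fin p → EuclideanSpace ℝ (Fin 4)), ℂ))
    {t τ : ℝ} (h1 : |τ - t| ≤ 1) :
    schwartzNorm M (translateMulti (EuclideanSpace.single 0 τ) H - translateMulti (EuclideanSpace.single 0 t) H) ≤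
      4 ^ M * schwartzNorm (M + 1) (translateMulti (EuclideanSpace.single 0 t) H) * |τ - t| := by
  have hc : ‖(fun _ : Fin p => EuclideanSpace.single (0 : Fin 4) (τ - t))‖ ≤ |τ - t| := by
    refine (pi_norm_const_le _).trans ?_
    rw [PiLp.norm_single, Real.norm_eq_abs]
  have heq : translateMulti (EuclideanSpace.single 0 τ) H =
      SchwartzMap.compSubConstCLM ℂ (fun _ : Fin p => EuclideanSpace.single (0 : Fin 4) (τ - t))
        (translateMulti (EuclideanSpace.single 0 t) H) := by
    ext x
    simp only [translateMulti_apply, SchwartzMap.compSubConstCLM_apply, Pi.sub_apply]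
    congr 1
    funext i; ext j
    by_cases hj : j = 0
    · subst hj; simp; ring
    · simp [hj]
  rw [heq]
  exact (schwartzNorm_compSubConstCLM_sub_le M _ (hc.trans h1)).trans
    (mul_le_mul_of_nonneg_left hc (mul_nonneg (pow_nonneg (by norm_num) _) (schwartzNorm_nonneg _ _)))

/-- **Exact lattice translation of the centred representative**: `𝔛ₖ(T_{a s e₀}H)(Ũ) = 𝔛ₖH(τ_{s e₀} Ũ)` for `H`
vanishing unless all times have modulus `≤ T`, `T + a (s + 1) ≤ a L` (the translated box strings stay in the box:
no boundary terms; `𝔛ₖ(T_{a s e₀}H)(Ũ)` is the lattice functional `Arp.lat` of the translate). [folklore] -/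
theorem csclCore_lat_translate (r : LatticeRep G) (sch : SpeciesScheme (YMSpecies G)) (k : ℕ) {m : ℕ}
    (H : 𝓢((Fin m → EuclideanSpace ℝ (Fin 4)), ℂ)) {T : ℝ} (sN : ℕ)
    (hH : ∀ x, H x ≠ 0 → ∀ i, |x i 0| ≤ T) (hfit : T + sch.a k * (sN + 1) ≤ sch.a k * sch.L k)
    (U : GaugeConfig 4 (sch.side k) G) :
    Arp.lat sch k (fun _ => Arp.cen r sch k r.curvature.F)
        (translateMulti (EuclideanSpace.single 0 (sch.a k * sN)) H) U =
      ∑ x : Fin m → ↥(box 4 (sch.L k)), H (fun i => sch.a k • siteToE (↑(x i) : Site 4)) *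
        ∏ i, ((r.curvature.F (Literature.MathematicalPhysics.QuantumLattice.configShift (-(↑(x i) : Site 4))
          (Literature.MathematicalPhysics.QuantumLattice.configShift (-(Pi.single 0 (sN : ℤ)))
            (torusLift (sch.side k) U))) - wilsonTorusMean r.ρ (sch.β k) (sch.L k) r.curvature.F : ℝ) : ℂ) := by
  -- adapted from instance A's `cscl_rep_translate` (Lines/Sketch17CS_helpers.lean, helper CsclRepB)
  classical
  simp only [Arp.lat, Arp.cen_apply]
  set P : LGConfig 4 G → ℝ := r.curvature.F
  set mb : ℝ := wilsonTorusMean r.ρ (sch.β k) (sch.L k) P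
  set V : LGConfig 4 G := torusLift (sch.side k) U
  set a : ℝ := sch.a k with ha_def
  have ha : 0 < a := sch.a_pos k
  set L := sch.L k
  set e : Site 4 := Pi.single 0 (sN : ℤ) with he
  have hsL := Arp.sum_boxFun_eq (L := L) (fun y : Fin m → Site 4 =>
    translateMulti (EuclideanSpace.single 0 (a * sN)) H (fun i => a • siteToE (y i)) *
      ∏ i, ((P (Literature.MathematicalPhysics.QuantumLattice.configShift (-(y i)) V) - mb : ℝ) : ℂ))
  have hsR := Arp.sum_boxFun_eq (L := L) (fun y : Fin m → Site 4 =>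
    H (fun i => a • siteToE (y i)) * ∏ i, ((P (Literature.MathematicalPhysics.QuantumLattice.configShift (-(y i))
      (Literature.MathematicalPhysics.QuantumLattice.configShift (-e) V)) - mb : ℝ) : ℂ))
  simp only at hsL hsR
  rw [hsL, hsR]
  -- pointwise: translated argument and composed shifts
  have hpt : ∀ y : Fin m → Site 4,
      (fun i => a • siteToE (y i) - EuclideanSpace.single (0 : Fin 4) (a * (sN : ℝ))) =
        fun i => a • siteToE (y i - e) := by
    intro y; funext i; ext j
    by_cases hj : j = 0
    · subst hj; simp [he, mul_sub]
    · simp [he, hj]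
  have hshift : ∀ y : Site 4, Literature.MathematicalPhysics.QuantumLattice.configShift (-y)
      (Literature.MathematicalPhysics.QuantumLattice.configShift (-e) V) =
      Literature.MathematicalPhysics.QuantumLattice.configShift (-(y + e)) V := by
    intro y; rw [Arp.configShift_configShift, neg_add]
  simp_rw [translateMulti_apply, hpt, hshift]
  -- support control: `H (a • y) ≠ 0` forces all time coordinates into the box before and after the shift
  have key : ∀ y : Fin m → Site 4, H (fun i => a • siteToE (y i)) ≠ 0 →
      ∀ i, -(L : ℤ) ≤ y i 0 ∧ y i 0 + sN ≤ L := by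
    intro y hy i
    have h1 := hH _ hy i
    simp only [PiLp.smul_apply, siteToE_apply, smul_eq_mul] at h1
    have h2 : |(y i 0 : ℝ)| * a ≤ T := by rw [abs_mul, abs_of_pos ha, mul_comm] at h1; exact h1
    have h3 : (|(y i 0 : ℝ)| + sN + 1) * a ≤ a * L := by nlinarith
    have h4 : |(y i 0 : ℝ)| + sN + 1 ≤ L := le_of_mul_le_mul_right (by nlinarith) ha
    constructor
    · have : -(L : ℝ) ≤ (y i 0 : ℝ) := by linarith [neg_abs_le (y i 0 : ℝ)]
      exact_mod_cast this
    · have : (y i 0 : ℝ) + sN ≤ L := by linarith [le_abs_self (y i 0 : ℝ)]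
      exact_mod_cast this
  have memiff : ∀ y : Fin m → Site 4, H (fun i => a • siteToE (y i)) ≠ 0 →
      (y ∈ Fintype.piFinset (fun _ : Fin m => box 4 L) ↔
        (fun i => y i + e) ∈ Fintype.piFinset (fun _ : Fin m => box 4 L)) := by
    intro y hy
    simp only [Fintype.mem_piFinset, mem_box]
    refine forall_congr' fun i => forall_congr' fun j => ?_
    by_cases hj : j = 0
    · subst hj
      obtain ⟨h0, h1⟩ := key y hy i
      simp only [Pi.add_apply, he, Pi.single_eq_same]
      omega
    · simp [he, hj]
  -- the bijection `x ↦ x - e` between the non-zero terms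
  refine Finset.sum_bij_ne_zero (fun x _ _ => fun i => x i - e) (fun x hx hne => ?_)
    (fun x₁ _ _ x₂ _ _ h => ?_) (fun y hy hne => ?_) (fun x _ _ => by simp only [sub_add_cancel])
  · have hH' : H (fun i => a • siteToE (x i - e)) ≠ 0 := left_ne_zero_of_mul hne
    exact (memiff (fun i => x i - e) hH').2 (by simpa using hx)
  · funext i; have := congrFun h i; simpa using this
  · refine ⟨fun i => y i + e, (memiff y (left_ne_zero_of_mul hne)).1 hy, ?_, ?_⟩
    · simpa using hne
    · funext i; simp

/-- **The pair bound at step `k`** (deterministic form of `stub_csclCore`): under the (UUVB) inequality at `k`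
(`α ≥ 0`), the uniform bound on `⁰𝒮` at `k`, `a_k < δ`, `a_k ≤ 1` and `T₀ + t + 1 ≤ a_k L_k`, the defect
`(𝓓_k(ΘF* ⊗ T_tH) − 𝓓_k(ΘF*) 𝓓_k(H)) − 𝒫°_{⌊t/a_k⌋₊}(𝔛ₖF, 𝔛ₖH)` has norm `≤ a_k K`, `K` independent of `k`
(rounding, matching with exact lattice translation, `𝓓_k(ΘF*) ≈ conj 𝓓_k(F)`, `𝓓_k(F) = E 𝔛ₖF`,
`𝓓_k(H) = E 𝔛ₖH`). [folklore] -/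
theorem csclCore_bound (r : LatticeRep G) (sch : SpeciesScheme (YMSpecies G)) (s : ℕ) (α β : ℝ) (hα : 0 ≤ α)
    (s₁ : ℕ) (α₁ β₁ : ℝ) {n m : ℕ} (F : 𝓢((Fin n → EuclideanSpace ℝ (Fin 4)), ℂ))
    (H : 𝓢((Fin m → EuclideanSpace ℝ (Fin 4)), ℂ)) {δ T₀ t : ℝ} (hδ : 0 < δ) (ht : 0 ≤ t)
    (hF : tsupport (F : (Fin n → EuclideanSpace ℝ (Fin 4)) → ℂ) ⊆
      {x | (∀ i, δ ≤ x i 0 ∧ x i 0 ≤ T₀) ∧ ∀ i i', i < i' → x i 0 + δ ≤ x i' 0})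
    (hH : tsupport (H : (Fin m → EuclideanSpace ℝ (Fin 4)) → ℂ) ⊆
      {x | (∀ i, δ ≤ x i 0 ∧ x i 0 ≤ T₀) ∧ ∀ i i', i < i' → x i 0 + δ ≤ x i' 0}) :
    ∃ K : ℝ, ∀ k : ℕ,
      (∀ (p : ℕ) (q : Fin p → PlaqIdx) (Fx : 𝓢((Fin p → EuclideanSpace ℝ (Fin 4)), ℂ)),
        IsOffDiagonal Fx → ‖canonDistribution r sch k p (fun i => plaq r (q i)) Fx‖ ≤
          α * (p.factorial : ℝ) ^ β * schwartzNorm (p * s) Fx) →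
      (∀ (p : ℕ) (Fx : 𝓢((Fin p → EuclideanSpace ℝ (Fin 4)), ℂ)), IsOffDiagonal Fx →
        ‖curvDistribution r sch k p Fx‖ ≤
          (Fintype.card PlaqIdx : ℝ) ^ p * (α₁ * (p.factorial : ℝ) ^ β₁ * schwartzNorm (p * s₁) Fx)) →
      sch.a k < δ → sch.a k ≤ 1 → T₀ + t + 1 ≤ sch.a k * sch.L k →
      ‖(curvDistribution r sch k (n + m)
            ((osAdjoint F).appendTensor (translateMulti (EuclideanSpace.single 0 t) H)) -
          curvDistribution r sch k n (osAdjoint F) * curvDistribution r sch k m H) -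
        ((∫ U, conj (Arp.lat sch k (fun _ => Arp.cen r sch k r.curvature.F) F U.negReflect) *
            (∑ x : Fin m → ↥(box 4 (sch.L k)), H (fun i => sch.a k • siteToE (↑(x i) : Site 4)) *
              ∏ i, ((r.curvature.F (Literature.MathematicalPhysics.QuantumLattice.configShift (-(↑(x i) : Site 4))
                (Literature.MathematicalPhysics.QuantumLattice.configShift (-(Pi.single 0 ((⌊t / sch.a k⌋₊ : ℕ) : ℤ)))
                  (torusLift (sch.side k) U))) -
                wilsonTorusMean r.ρ (sch.β k) (sch.L k) r.curvature.F : ℝ) : ℂ)) ∂(μW r sch k)) -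
          conj (∫ U, Arp.lat sch k (fun _ => Arp.cen r sch k r.curvature.F) F U ∂(μW r sch k)) *
            ∫ U, Arp.lat sch k (fun _ => Arp.cen r sch k r.curvature.F) H U ∂(μW r sch k))‖ ≤ sch.a k * K := by
  set M := (n + m) * s with hM
  set M₁ := (n + m) * s₁ with hM₁
  set Ht := translateMulti (EuclideanSpace.single (0 : Fin 4) t) H with hHt
  -- the three `k`-uniform constants and the uniform bound on `𝓓_k(H)`
  set c₀ : ℝ := (Fintype.card PlaqIdx : ℝ) ^ (n + m) * (α₁ * ((n + m).factorial : ℝ) ^ β₁) with hc₀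
  set K₀ : ℝ := |c₀| * (2 ^ (M₁ + 1) * schwartzNorm M₁ (osAdjoint F) * (4 ^ M₁ * schwartzNorm (M₁ + 1) Ht))
    with hK₀
  set K₁ : ℝ := ∑ _q : Fin n → PlaqIdx, ∑ _q' : Fin m → PlaqIdx, α * ((n + m).factorial : ℝ) ^ β *
    (2 ^ (M + 1) * (4 ^ M * schwartzNorm (M + 1) (Arp.Ftil F)) *
      (schwartzNorm M Ht + 4 ^ M * schwartzNorm (M + 1) Ht)) with hK₁
  set K₂ : ℝ := ∑ _q : Fin n → PlaqIdx, α * (n.factorial : ℝ) ^ β *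
    (4 ^ (n * s) * schwartzNorm (n * s + 1) (Arp.Ftil F)) with hK₂
  set CH : ℝ := (Fintype.card PlaqIdx : ℝ) ^ m * (α₁ * (m.factorial : ℝ) ^ β₁ * schwartzNorm (m * s₁) H) with hCH
  refine ⟨K₀ + K₁ + K₂ * CH, fun k hUk hDk ha ha1 hT => ?_⟩
  have ha0 : 0 < sch.a k := sch.a_pos k
  obtain ⟨hτ0, hτt, hτa⟩ := csclCore_floor (t := t) ha0 ht
  set sN : ℕ := ⌊t / sch.a k⌋₊ with hsN
  have habs : |sch.a k * sN - t| ≤ sch.a k := by rw [abs_sub_comm, abs_of_nonneg (sub_nonneg.2 hτt)]; exact hτa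
  have h4M : ∀ N : ℕ, (0 : ℝ) ≤ 4 ^ N * schwartzNorm (N + 1) Ht := fun N =>
    mul_nonneg (pow_nonneg (by norm_num) _) (schwartzNorm_nonneg _ _)
  -- (2) MATCHING (conjunct (i) of the OS matching in the slab `[δ, T₀ + t]`) and exact lattice translation
  have hF' : tsupport (F : (Fin n → EuclideanSpace ℝ (Fin 4)) → ℂ) ⊆
      {x | (∀ i, δ ≤ x i 0 ∧ x i 0 ≤ T₀ + t) ∧ ∀ i i', i < i' → x i 0 + δ ≤ x i' 0} :=
    hF.trans fun x hx => ⟨fun i => ⟨(hx.1 i).1, (hx.1 i).2.trans (le_add_of_nonneg_right ht)⟩, hx.2⟩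
  have hMt := osMatching_pair_bound r sch k hα hUk F (translateMulti (EuclideanSpace.single 0 (sch.a k * sN)) H)
    hF' (csclCore_tsupport_translate hτ0 hτt hH) hδ ha ha1 (by linarith)
  simp only [csclCore_lat_translate r sch k H sN (osMatching_abs_time_le hδ hH)
    (by nlinarith : T₀ + sch.a k * (sN + 1) ≤ sch.a k * sch.L k)] at hMt
  set Hτ := translateMulti (EuclideanSpace.single (0 : Fin 4) (sch.a k * sN)) H with hHτ
  have hN : schwartzNorm M Hτ ≤ schwartzNorm M Ht + 4 ^ M * schwartzNorm (M + 1) Ht := by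
    have h := map_add_le_add ((Finset.Iic (M, M)).sup (schwartzSeminormFamily ℂ _ ℂ)) Ht (Hτ - Ht)
    rw [add_sub_cancel] at h
    refine h.trans (add_le_add le_rfl ?_)
    exact (csclCore_schwartzNorm_translate_sub M H (habs.trans ha1)).trans
      ((mul_le_mul_of_nonneg_left (habs.trans ha1) (h4M M)).trans (le_of_eq (mul_one _)))
  have hfac : (0 : ℝ) ≤ α * ((n + m).factorial : ℝ) ^ β := by positivity
  have hMt' : _ ≤ sch.a k * K₁ := hMt.trans (mul_le_mul_of_nonneg_left (Finset.sum_le_sum fun q _ =>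
    Finset.sum_le_sum fun q' _ => mul_le_mul_of_nonneg_left (mul_le_mul_of_nonneg_left hN
      (mul_nonneg (pow_nonneg (by norm_num) _) (mul_nonneg (pow_nonneg (by norm_num) _) (schwartzNorm_nonneg _ _))))
      hfac) ha0.le)
  -- (1) ROUNDING `t ↦ a_k ⌊t / a_k⌋₊`
  have hR : ‖curvDistribution r sch k (n + m) ((osAdjoint F).appendTensor Ht) -
      curvDistribution r sch k (n + m) ((osAdjoint F).appendTensor Hτ)‖ ≤ sch.a k * K₀ := by
    rw [← curvDistribution_sub, ← SchwartzMap.appendTensor_sub_right]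
    have hoff : IsOffDiagonal ((osAdjoint F).appendTensor (Ht - Hτ)) :=
      isOffDiagonal_appendTensor_of_neg_of_pos (csclCore_tsupport_osAdjoint hδ hF)
        ((tsupport_sub_subset _ _).trans ((Set.union_subset
          (csclCore_tsupport_translate ht le_rfl hH) (csclCore_tsupport_translate hτ0 hτt hH)).trans
          (csclCore_slab_subset_pos hδ)))
    refine (hDk (n + m) _ hoff).trans ?_
    have h1 : schwartzNorm M₁ ((osAdjoint F).appendTensor (Ht - Hτ)) ≤
        2 ^ (M₁ + 1) * schwartzNorm M₁ (osAdjoint F) * schwartzNorm M₁ (Ht - Hτ) :=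
      schwartzNorm_appendTensor_le _ _ M₁
    have h2 : schwartzNorm M₁ (Ht - Hτ) ≤ 4 ^ M₁ * schwartzNorm (M₁ + 1) Ht * sch.a k := by
      rw [← neg_sub, show schwartzNorm M₁ (-(Hτ - Ht)) = schwartzNorm M₁ (Hτ - Ht) from map_neg_eq_map _ _]
      exact (csclCore_schwartzNorm_translate_sub M₁ H (habs.trans ha1)).trans
        (mul_le_mul_of_nonneg_left habs (h4M M₁))
    calc (Fintype.card PlaqIdx : ℝ) ^ (n + m) *
          (α₁ * ((n + m).factorial : ℝ) ^ β₁ * schwartzNorm ((n + m) * s₁) ((osAdjoint F).appendTensor (Ht - Hτ)))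
        = c₀ * schwartzNorm M₁ ((osAdjoint F).appendTensor (Ht - Hτ)) := by rw [hc₀, hM₁]; ring
      _ ≤ |c₀| * (2 ^ (M₁ + 1) * schwartzNorm M₁ (osAdjoint F) * (4 ^ M₁ * schwartzNorm (M₁ + 1) Ht * sch.a k)) := by
          refine (mul_le_mul_of_nonneg_right (le_abs_self c₀) (schwartzNorm_nonneg _ _)).trans ?_
          refine mul_le_mul_of_nonneg_left (h1.trans ?_) (abs_nonneg c₀)
          exact mul_le_mul_of_nonneg_left h2 (mul_nonneg (pow_nonneg (by norm_num) _) (schwartzNorm_nonneg _ _))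
      _ = sch.a k * K₀ := by rw [hK₀]; ring
  -- (3) the single matching, the means, and the algebra `(A − b c) − (P − ē c) = (A − A') + (A' − P) − (b − ē) c`
  have hS := osMatching_single_bound r sch k hα hUk F hF hδ ha ha1 (by linarith : T₀ + sch.a k ≤ sch.a k * sch.L k)
  have hC : ‖curvDistribution r sch k m H‖ ≤ CH := hDk m H (csclCore_isOffDiagonal_of_slab hδ hH)
  rw [← Arp.curvDistribution_eq_integral_lat r sch k n F, ← Arp.curvDistribution_eq_integral_lat r sch k m H]
  have hK₂0 : 0 ≤ sch.a k * K₂ := (norm_nonneg _).trans hS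
  have key : ∀ A A' P b c e : ℂ, ‖(A - b * c) - (P - e * c)‖ ≤ ‖A - A'‖ + ‖A' - P‖ + ‖b - e‖ * ‖c‖ := by
    intro A A' P b c e
    rw [show (A - b * c) - (P - e * c) = (A - A') + (A' - P) - (b - e) * c by ring, ← norm_mul]
    exact (norm_sub_le _ _).trans (add_le_add (norm_add_le _ _) le_rfl)
  refine (key _ _ _ _ _ _).trans ((add_le_add (add_le_add hR hMt') (mul_le_mul hS hC (norm_nonneg _) hK₂0)).trans ?_)
  exact le_of_eq (by ring)

end Helpers

/-- `stub_csclCore` — **per-datum matching and time rounding at the scheme level, pair clause** (registered stub of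
stmt-QuantumFields-15828, line `Sketch`, reshape 18b): under the (UUVB) clause of the scheme, for `F`, `H` supported
at ordered positive times in `[δ, T₀]` with gaps `≥ δ` and `t ≥ 0`, the continuum-side cluster defect
`𝓓_k(ΘF* ⊗ T_tH) − 𝓓_k(ΘF*) 𝓓_k(H)` and the lattice-side truncated OS pairing `𝒫°_{⌊t/a_k⌋₊}(𝔛ₖF, 𝔛ₖH)` of the
centred lattice representatives agree up to `ε`, eventually in `k` (`csclCore_bound`: rounding `t ↦ a_k⌊t/a_k⌋₊`
by the `k`-uniform E0′ bound from (UUVB), `stub_osMatching` (i)/(ii), exact lattice translation; `a_k → 0`,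
`a_k L_k → ∞`). [folklore] -/
theorem stub_csclCore :
    ∀ (G : Type) [Group G] [TopologicalSpace G] [IsTopologicalGroup G] [CompactSpace G]
      [MeasurableSpace G] [BorelSpace G] (r : LatticeRep G) (sch : SpeciesScheme (YMSpecies G)) (n m : ℕ)
      (F : SchwartzMap (Fin n → EuclideanSpace ℝ (Fin 4)) ℂ) (H : SchwartzMap (Fin m → EuclideanSpace ℝ (Fin 4)) ℂ)
      (δ T₀ t : ℝ), 0 < δ → 0 ≤ t →
      tsupport (F : (Fin n → EuclideanSpace ℝ (Fin 4)) → ℂ) ⊆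
        {x | (∀ i, δ ≤ x i 0 ∧ x i 0 ≤ T₀) ∧ ∀ i i', i < i' → x i 0 + δ ≤ x i' 0} →
      tsupport (H : (Fin m → EuclideanSpace ℝ (Fin 4)) → ℂ) ⊆
        {x | (∀ i, δ ≤ x i 0 ∧ x i 0 ≤ T₀) ∧ ∀ i i', i < i' → x i 0 + δ ≤ x i' 0} →
      (∃ (s : ℕ) (α β' : ℝ), ∀ᶠ k in atTop, ∀ (p : ℕ) (q : Fin p → {q : Fin 4 × Fin 4 // q.1 < q.2})
        (Fx : SchwartzMap (Fin p → EuclideanSpace ℝ (Fin 4)) ℂ), IsOffDiagonal Fx →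
        ‖∫ U : GaugeConfig 4 (sch.side k) G, ∑ x : Fin p → ↥(box 4 (sch.L k)),
            Fx (fun i => sch.a k • siteToE ↑(x i)) *
              ∏ i, ((plaquetteObs r.ρ 0 (q i).1.1 (q i).1.2 (configShift (-↑(x i)) (torusLift (sch.side k) U)) -
                wilsonTorusMean r.ρ (sch.β k) (sch.L k) (plaquetteObs r.ρ 0 (q i).1.1 (q i).1.2) : ℝ) : ℂ)
            ∂(wilsonMeasure r.ρ (sch.β k))‖ ≤ α * (p.factorial : ℝ) ^ β' * schwartzNorm (p * s) Fx) →
      ∀ ε : ℝ, 0 < ε → ∀ᶠ k : ℕ in atTop,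
        ‖(curvDistribution r sch k (n + m) ((osAdjoint F).appendTensor (translateMulti (EuclideanSpace.single 0 t) H)) -
            curvDistribution r sch k n (osAdjoint F) * curvDistribution r sch k m H) -
          ((∫ U : GaugeConfig 4 (2 * sch.L k + 1) G, (starRingEnd ℂ) ((fun V => ∑ x : Fin n → ↥(box 4 (sch.L k)), F (fun i => sch.a k • siteToE ↑(x i)) * ∏ i, ((r.curvature.F (configShift (-↑(x i)) V) - wilsonTorusMean r.ρ (sch.β k) (sch.L k) r.curvature.F : ℝ) : ℂ)) (cfgReflect (torusLift (2 * sch.L k + 1) U))) * (fun V => ∑ x : Fin m → ↥(box 4 (sch.L k)), H (fun i => sch.a k • siteToE ↑(x i)) * ∏ i, ((r.curvature.F (configShift (-↑(x i)) V) - wilsonTorusMean r.ρ (sch.β k) (sch.L k) r.curvature.F : ℝ) : ℂ)) (configShift (-(Pi.single 0 ((⌊t / sch.a k⌋₊ : ℕ) : ℤ))) (torusLift (2 * sch.L k + 1) U)) ∂(wilsonMeasure r.ρ (sch.β k))) - (starRingEnd ℂ) (∫ U : GaugeConfig 4 (2 * sch.L k + 1) G, (fun V => ∑ x : Fin n → ↥(box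 4 (sch.L k)), F (fun i => sch.a k • siteToE ↑(x i)) * ∏ i, ((r.curvature.F (configShift (-↑(x i)) V) - wilsonTorusMean r.ρ (sch.β k) (sch.L k) r.curvature.F : ℝ) : ℂ)) (torusLift (2 * sch.L k + 1) U) ∂(wilsonMeasure r.ρ (sch.β k))) * (∫ U : GaugeConfig 4 (2 * sch.L k + 1) G, (fun V => ∑ x : Fin m → ↥(box 4 (sch.L k)), H (fun i => sch.a k • siteToE ↑(x i)) * ∏ i, ((r.curvature.F (configShift (-↑(x i)) V) - wilsonTorusMean r.ρ (sch.β k) (sch.L k) r.curvature.F : ℝ) : ℂ)) (torusLift (2 * sch.L k + 1) U) ∂(wilsonMeasure r.ρ (sch.β k))))‖ ≤ ε := by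
  intro G _ _ _ _ _ _ r sch n m F H δ T₀ t hδ ht hF hH hU ε hε
  obtain ⟨s, α, β', hev⟩ := hU
  -- the (UUVB) inequality with `α` implies the one with `max α 0 ≥ 0`
  have hev' : ∀ᶠ k in atTop, ∀ (p : ℕ) (q : Fin p → PlaqIdx) (Fx : 𝓢((Fin p → EuclideanSpace ℝ (Fin 4)), ℂ)),
      IsOffDiagonal Fx → ‖canonDistribution r sch k p (fun i => plaq r (q i)) Fx‖ ≤
        max α 0 * (p.factorial : ℝ) ^ β' * schwartzNorm (p * s) Fx :=
    hev.mono fun k hk p q Fx hFx => (hk p q Fx hFx).trans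
      (mul_le_mul_of_nonneg_right (mul_le_mul_of_nonneg_right (le_max_left α 0)
        (Real.rpow_nonneg (Nat.cast_nonneg _) _)) (schwartzNorm_nonneg _ _))
  -- the `k`-uniform E0′ bound on `⁰𝒮` from (UUVB), and the deterministic pair bound
  obtain ⟨s₁, α₁, β₁, hD⟩ := Transl.norm_curvDistribution_le_of_uuvb r sch ⟨s, max α 0, β', hev'⟩
  obtain ⟨K, hK⟩ := csclCore_bound r sch s (max α 0) β' (le_max_right α 0) s₁ α₁ β₁ F H hδ ht hF hH
  -- the side conditions hold eventually along the scheme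
  have ha : ∀ᶠ k : ℕ in atTop, sch.a k < δ := sch.tendsto_a.eventually (eventually_lt_nhds hδ)
  have ha1 : ∀ᶠ k : ℕ in atTop, sch.a k ≤ 1 := sch.tendsto_a.eventually (eventually_le_nhds one_pos)
  have hT : ∀ᶠ k : ℕ in atTop, T₀ + t + 1 ≤ sch.a k * sch.L k :=
    sch.tendsto_L.eventually (eventually_ge_atTop _)
  have hKε : ∀ᶠ k : ℕ in atTop, sch.a k * |K| ≤ ε := by
    have h : Tendsto (fun k => sch.a k * |K|) atTop (𝓝 (0 * |K|)) := sch.tendsto_a.mul_const _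
    rw [zero_mul] at h
    exact h.eventually (eventually_le_nhds hε)
  filter_upwards [hev', hD, ha, ha1, hT, hKε] with k hUk hDk hak ha1k hTk hKk
  simp only [← torusLift_negReflect]
  refine (hK k hUk hDk hak ha1k hTk).trans ?_
  exact (mul_le_mul_of_nonneg_left (le_abs_self K) (sch.a_pos k).le).trans hKk

end Summit.QuantumFields.YangMills.Theorems.ContinuumLegGivenGap

end
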